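import Summits.HubbardSuperconductivity.HubbardSuperconductivity.Theorems.AnisotropyChordTransferFibre3Hole2L33a
import Summits.HubbardSuperconductivity.HubbardSuperconductivity.Theorems.AnisotropyChordTransferFibre3Hole2L33b
import Summits.HubbardSuperconductivity.HubbardSuperconductivity.Theorems.AnisotropyChordTransferFibre3Hole2L33c
import Summits.HubbardSuperconductivity.HubbardSuperconductivity.Theorems.AnisotropyChordTransferFibre3Hole2Cover

/-!
# Route `AnisotropyChord` / H0 rotor rung: ★ HOLE₂(.75) AT `L = 33` — `TwoHoleGap 33 (3/4·eps1 33)`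

The one-body spectral input of the GM₃ assembly `gm3_of_hole2` (p1 g23) at side length `L = 33` (first side lengths of the analytic
regime above the FIN range `9 ≤ L ≤ 32` of `…Hole2FinRange`): the Neumann gap of the rate-½ walk on the `33 × 33` torus with ANY two
vertices deleted is at least `¾ε₁(33)`.  Assembly of the kernel facts `checkRepsQ_33a…` (3 parts, the 152 `D₄`-classes `repList 33`)
via `checkRepsQ_append`, the identification with `repList 33` (`decide`), and `Hole2.twoHoleGap_of_checkRepsQ_repList` (`…Fibre3Hole2Cover`).
Prover seat `hubbard-h0-rotor-p3` g3; helper for stmt-HubbardSuperconductivity-19089 (`--supports`, helper class).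
WHAT THIS IS NOT: nothing here proves superconductivity in the Hubbard model (rotor TARGET as worded stays FALSE, g15 verdict); this
discharges, at ONE side length, ONE hypothesis (HOLE₂(.75)) of ONE conditional reduction (rung 19089). Tree imports only; no sorry.
-/

set_option linter.dupNamespace false
set_option autoImplicit false

namespace Summit.HubbardSuperconductivity.HubbardSuperconductivity.Theorems.AnisotropyChord.Transfer.Fibre3

namespace Hole2

/-- the kernel-fact parts list exactly `repList 33`. [folklore] -/
theorem repList_33_eq : repList 33 = reps33a ++ reps33b ++ reps33c := by
  decide +kernel

/-- every representative separation of the `33 × 33` torus passes the kernel check. [folklore] -/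
theorem checkRepsQ_repList_33 : checkRepsQ 33 (repList 33) = true := by
  rw [repList_33_eq]
  exact checkRepsQ_append (checkRepsQ_append (checkRepsQ_33a) checkRepsQ_33b) checkRepsQ_33c

/-- ★★★ HOLE₂(.75) AT `L = 33`: `TwoHoleGap 33 (3/4 * eps1 33)`, the spectral hypothesis of `gm3_of_hole2` at `L = 33`. [folklore] -/
theorem twoHoleGap_thirtyThree : TwoHoleGap 33 (3 / 4 * eps1 33) :=
  twoHoleGap_of_checkRepsQ_repList 33 checkRepsQ_repList_33

end Hole2

end Summit.HubbardSuperconductivity.HubbardSuperconductivity.Theorems.AnisotropyChord.Transfer.Fibre3
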